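import Literature.IUT.HodgeArakelov.LabelClassesOfCuspsCor24iH25Flat
import Literature.IUT.HodgeTheaters.StableCurveTemperedDataOfSpecialFibreProp24Compact

/-!
# [IUTchII] Cor. 2.4 (i): the three cone closers RE-CLOSED at the genuine `X̲̲_v`-datum `ofSpecialFibre` (C-R33 / K4)

S. Mochizuki, *Inter-universal Teichmüller theory II*, kurims manuscript (Dec. 2020), §2, Cor. 2.4 (i) pp. 69–71;
*Inter-universal Teichmüller theory I*, kurims manuscript (May 2020), §2, Prop. 2.4 (iii) p. 50, Cor. 2.5 p. 51
([IUTchII] Cor 2.4 (i), kurims pp.69-71) [claim: Mochizuki2012, status: disputed] (D-0012 claim key; the series is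
DISPUTED; nothing printed is asserted here).

abc-iut cell, sub-cell L-K/R-C (D-0079), seat abc-iut-w4-d009 gen 7, node `IUTchII:Cor2.4(i)`.  RULING C-R33
(abc-iut-plan g9, 2026-08-26T15:07:08Z): a cone node whose closing theorem binds a FACT-LIST row of class
«refuted-closure» is discharged VACUOUSLY-AS-TYPED until re-closed against the row's surviving instance form.
abc-iut-c312-2's `CONE-K4-RECLOSE.tsv` v3/v4 classes `IUTchII:Cor2.4(i)` as BLOCKED: its three closers
(`PlusMinusTower.h25_of_hatData`, `cor24_i_of_hatData`, `cor24_i'_of_hatData`, abc-iut-w5-d132,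
`LabelClassesOfCuspsCor24iH25Flat`) bind `h24 : Dflat.Prop24iii` (F-2601) and `h25D : Dflat.Cor25Inertia` (F-2603),
and the producers scan (conclusion HEAD = the row) finds no closed producer of `Cor25Inertia` — because the tree's
producers conclude the CONJUNCTION `Cor25Decomposition ∧ Cor25Inertia`
(abc-iut-L5-t11 `StableCurveTemperedData.cor25_ofSpecialFibre`, abc-iut-L5 `OfSpecialFibre.cor25_ofSpecialFibre_of_compactSpace`).

THIS PROOF-ONLY FILE (no `def`, no Prop fact, no `instance`, no `sorry`) writes the three re-closures at the GENUINE
[IUTchI] §2 𝔛-datum `StableCurveTemperedData.ofSpecialFibre X d S …` of a tempered curve `X` with special-fibre data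
(abc-iut-L5 lineage, `StableCurveTemperedDataOfSpecialFibre`), in the regime in which both rows are THEOREMS there
with no `Prop` binder: `Π^temp_{X_K}` compact, `X` with a closed point and a cusp
(`OfSpecialFibre.prop24iii_ofSpecialFibre_of_compactSpace`, `OfSpecialFibre.cor25_ofSpecialFibre_of_compactSpace`).
Every other binder of the closers is kept VERBATIM (the `X̲̲_v`-level identification data `e`, `hmap`, `hinertia`,
`hSig`, the covering facts `hinf`, `hnot`, and the printed inputs (B)/(C) `h23vi`/`h23v`/`h23` — none of them a
FACT-LIST row).  Universe: the genuine constructor lives in `Type 0`, so the closers (universe-polymorphic) are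
instantiated at `u := 0`.

HONEST FRAMING: re-closed ≠ endorsed; «compact `Π^temp_{X_K}`» is a degenerate regime of OUR typed interface (the
profinite-completion map is onto), recorded as such by abc-iut-L5's file; typed ≠ proved-as-printed; no side taken
on [IUTchIII] Cor. 3.12; nothing here asserts that abc is proved or refuted. [claim: Mochizuki2012, status: disputed]
-/

namespace Literature.IUT.HodgeArakelov

open Literature.IUT.HodgeTheaters
open Literature.AnabelianGeometry.SemiGraphs
open scoped Pointwise

section Cor24iReclosed

variable {S : BadPlaceSetting.{0}} {P : TopGroup.{0}} {T : TemperedCoverings S P}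
  (W : PlusMinusTower T) (C : CuspidalInertiaData W)

variable {p : ℕ} [Fact p.Prime] (X : TemperedCurve p) (d : X.GroupLevelData)
  (SF : SpecialFibreData (X.toTemperedArithmeticGroup d)) (h36 : SF.Gc.Prop36Hypotheses)
  (Sigma SigmaHat : Set ℕ) (hsub : Sigma ⊆ SigmaHat) (hne : Sigma.Nonempty)
  (hprime : ∀ q ∈ SigmaHat, q.Prime) (hp : p ∉ Sigma) (TpH : Subgroup SF.chart.G)
  (HatH : Subgroup (TemperedGraphGroupData.exists_completion_of_prop36 SF.Gc h36 SF.chart).choose)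
  (hle : TpH.map (TemperedGraphGroupData.exists_completion_of_prop36 SF.Gc h36
    SF.chart).choose_spec.choose.toMonoidHom ≤ HatH)
  (cuspMeetsH : {x : X.Pt // X.IsCusp x} → Prop)
  [CompactSpace X.PiTemp] [Nonempty X.Pt] [Nonempty {x : X.Pt // X.IsCusp x}]

/-- **IUTchII:Cor2.4(i), input `h25`, RE-CLOSED (C-R33)** at `Dflat := ofSpecialFibre X d S …` ("by [IUTchI],
Corollary 2.5 …, the inclusion `I^{γ'}_t ⊆ Π^±_{v□} ⊆ Π^±_v` implies that `γ' ∈ Δ^±_v`", kurims II p. 70):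
abc-iut-w5-d132's `PlusMinusTower.h25_of_hatData` with `h25D := (cor25_ofSpecialFibre_of_compactSpace …).2` and
`h24 := prop24iii_ofSpecialFibre_of_compactSpace …`.  Remaining hypotheses: the identification data `e`, `hmap`,
`hinertia`, `hSig`, and the covering facts `hinf`, `hnot` — no FACT-LIST row.
([IUTchII] Cor 2.4 (i) p.70) [claim: Mochizuki2012, status: disputed] -/
theorem PlusMinusTower.h25_of_hatData_ofSpecialFibre
    (e : W.hat ≃* (StableCurveTemperedData.ofSpecialFibre X d SF h36 Sigma SigmaHat hsub hne hprime hp TpH HatH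
      hle cuspMeetsH).PiHat)
    (hmap : (W.piV.subgroupOf W.hat).map e.toMonoidHom =
      (StableCurveTemperedData.ofSpecialFibre X d SF h36 Sigma SigmaHat hsub hne hprime hp TpH HatH hle
        cuspMeetsH).ιX.range)
    (hinertia : ∀ I : Subgroup W.Corhat, C.IsCuspidalInertia W.piV I →
      ∃ (x : (StableCurveTemperedData.ofSpecialFibre X d SF h36 Sigma SigmaHat hsub hne hprime hp TpH HatH hle
          cuspMeetsH).Cusp)
        (t : (StableCurveTemperedData.ofSpecialFibre X d SF h36 Sigma SigmaHat hsub hne hprime hp TpH HatH hle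
          cuspMeetsH).PiTp),
        (I.subgroupOf W.hat).map e.toMonoidHom =
          (MulAut.conj t • ((StableCurveTemperedData.ofSpecialFibre X d SF h36 Sigma SigmaHat hsub hne hprime hp
              TpH HatH hle cuspMeetsH).inertiaTp x).map
            (StableCurveTemperedData.ofSpecialFibre X d SF h36 Sigma SigmaHat hsub hne hprime hp TpH HatH hle
              cuspMeetsH).DeltaTp.subtype).map
            (StableCurveTemperedData.ofSpecialFibre X d SF h36 Sigma SigmaHat hsub hne hprime hp TpH HatH hle
              cuspMeetsH).ιX)
    (hSig : (StableCurveTemperedData.ofSpecialFibre X d SF h36 Sigma SigmaHat hsub hne hprime hp TpH HatH hle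
      cuspMeetsH).graph.SigmaHat = {q | q.Prime})
    (hinf : W.piPM ⊓ W.hat ≤ W.piV) (hnot : ¬ (W.piPM ⊓ W.aug.ker ≤ W.hat))
    {I : Subgroup W.Corhat} (hI : C.IsCuspidalInertia W.piV I) :
    ∀ γ' : W.Corhat, γ' ∈ W.pmHat ⊓ W.aug.ker →
      I.map (MulAut.conj γ').toMonoidHom ≤ W.piPM → γ' ∈ W.piPM :=
  W.h25_of_hatData C _ e hmap hinertia hSig
    (StableCurveTemperedData.OfSpecialFibre.cor25_ofSpecialFibre_of_compactSpace X d SF h36 Sigma SigmaHat hsub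
      hne hprime hp TpH HatH hle cuspMeetsH).2
    (StableCurveTemperedData.OfSpecialFibre.prop24iii_ofSpecialFibre_of_compactSpace X d SF h36 Sigma SigmaHat
      hsub hne hprime hp TpH HatH hle cuspMeetsH)
    hinf hnot hI

/-- **IUTchII:Cor2.4(i) RE-CLOSED (C-R33)** — the typed `Cor24_i W C H I` for ANY `Π_{v□}`, at
`Dflat := ofSpecialFibre X d S …`: abc-iut-w5-d132's `cor24_i_of_hatData` with the two [IUTchI] rows supplied by
`cor25_ofSpecialFibre_of_compactSpace` / `prop24iii_ofSpecialFibre_of_compactSpace`.  Remaining hypotheses: `e`,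
`hmap`, `hinertia`, `hSig`, `hinf`, `hnot`, and the printed inputs (B) `h23vi` (Cor. 2.3 (vi)) / (C) `h23v`
(Cor. 2.3 (ii)+(v)) — no FACT-LIST row. ([IUTchII] Cor 2.4 (i) pp.70-71) [claim: Mochizuki2012, status: disputed] -/
theorem cor24_i_of_hatData_ofSpecialFibre (H : Subgroup P) (I : Subgroup W.Corhat)
    (e : W.hat ≃* (StableCurveTemperedData.ofSpecialFibre X d SF h36 Sigma SigmaHat hsub hne hprime hp TpH HatH
      hle cuspMeetsH).PiHat)
    (hmap : (W.piV.subgroupOf W.hat).map e.toMonoidHom =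
      (StableCurveTemperedData.ofSpecialFibre X d SF h36 Sigma SigmaHat hsub hne hprime hp TpH HatH hle
        cuspMeetsH).ιX.range)
    (hinertia : ∀ I : Subgroup W.Corhat, C.IsCuspidalInertia W.piV I →
      ∃ (x : (StableCurveTemperedData.ofSpecialFibre X d SF h36 Sigma SigmaHat hsub hne hprime hp TpH HatH hle
          cuspMeetsH).Cusp)
        (t : (StableCurveTemperedData.ofSpecialFibre X d SF h36 Sigma SigmaHat hsub hne hprime hp TpH HatH hle
          cuspMeetsH).PiTp),
        (I.subgroupOf W.hat).map e.toMonoidHom =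
          (MulAut.conj t • ((StableCurveTemperedData.ofSpecialFibre X d SF h36 Sigma SigmaHat hsub hne hprime hp
              TpH HatH hle cuspMeetsH).inertiaTp x).map
            (StableCurveTemperedData.ofSpecialFibre X d SF h36 Sigma SigmaHat hsub hne hprime hp TpH HatH hle
              cuspMeetsH).DeltaTp.subtype).map
            (StableCurveTemperedData.ofSpecialFibre X d SF h36 Sigma SigmaHat hsub hne hprime hp TpH HatH hle
              cuspMeetsH).ιX)
    (hSig : (StableCurveTemperedData.ofSpecialFibre X d SF h36 Sigma SigmaHat hsub hne hprime hp TpH HatH hle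
      cuspMeetsH).graph.SigmaHat = {q | q.Prime})
    (hinf : W.piPM ⊓ W.hat ≤ W.piV) (hnot : ¬ (W.piPM ⊓ W.aug.ker ≤ W.hat))
    (h23vi : ∀ γ' : W.Corhat, γ' ∈ W.piPM ⊓ W.aug.ker →
      I.map (MulAut.conj γ').toMonoidHom ≤ W.pmBox H → γ' ∈ closure (W.deltaPmBox H : Set W.Corhat))
    (h23v : ∀ γ' : W.Corhat, γ' ∈ W.piPM ⊓ W.aug.ker →
      γ' ∈ closure (W.deltaPmBox H : Set W.Corhat) → γ' ∈ W.deltaPmBox H) :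
    Literature.IUT.HodgeArakelov.Cor24_i W C H I :=
  cor24_i_of_hatData W C _ H I e hmap hinertia hSig
    (StableCurveTemperedData.OfSpecialFibre.cor25_ofSpecialFibre_of_compactSpace X d SF h36 Sigma SigmaHat hsub
      hne hprime hp TpH HatH hle cuspMeetsH).2
    (StableCurveTemperedData.OfSpecialFibre.prop24iii_ofSpecialFibre_of_compactSpace X d SF h36 Sigma SigmaHat
      hsub hne hprime hp TpH HatH hle cuspMeetsH)
    hinf hnot h23vi h23v

variable {D : EtaleThetaData S.toThetaSetting P} (Dec : SubgraphDecomposition S T D)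
  {L : LabCuspStructure C} (Ld : LabelledDecomposition Dec L)

/-- **IUTchII:Cor2.4(i)′ RE-CLOSED (C-R33)** — the decl of record `Cor24_i' Dec W C Ld I` (printed family
`□ ∈ {•t, ▶}`), at `Dflat := ofSpecialFibre X d S …`: abc-iut-w5-d132's `cor24_i'_of_hatData` with the two [IUTchI]
rows supplied as above.  Remaining hypotheses: `e`, `hmap`, `hinertia`, `hSig`, `hinf`, `hnot`, and the printed
inputs (B)/(C) per admissible `Π_{v□}` (`h23`) — no FACT-LIST row. ([IUTchII] Cor 2.4 (i) pp.70-71)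
[claim: Mochizuki2012, status: disputed] -/
theorem cor24_i'_of_hatData_ofSpecialFibre (I : Subgroup W.Corhat)
    (e : W.hat ≃* (StableCurveTemperedData.ofSpecialFibre X d SF h36 Sigma SigmaHat hsub hne hprime hp TpH HatH
      hle cuspMeetsH).PiHat)
    (hmap : (W.piV.subgroupOf W.hat).map e.toMonoidHom =
      (StableCurveTemperedData.ofSpecialFibre X d SF h36 Sigma SigmaHat hsub hne hprime hp TpH HatH hle
        cuspMeetsH).ιX.range)
    (hinertia : ∀ I : Subgroup W.Corhat, C.IsCuspidalInertia W.piV I →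
      ∃ (x : (StableCurveTemperedData.ofSpecialFibre X d SF h36 Sigma SigmaHat hsub hne hprime hp TpH HatH hle
          cuspMeetsH).Cusp)
        (t : (StableCurveTemperedData.ofSpecialFibre X d SF h36 Sigma SigmaHat hsub hne hprime hp TpH HatH hle
          cuspMeetsH).PiTp),
        (I.subgroupOf W.hat).map e.toMonoidHom =
          (MulAut.conj t • ((StableCurveTemperedData.ofSpecialFibre X d SF h36 Sigma SigmaHat hsub hne hprime hp
              TpH HatH hle cuspMeetsH).inertiaTp x).map
            (StableCurveTemperedData.ofSpecialFibre X d SF h36 Sigma SigmaHat hsub hne hprime hp TpH HatH hle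
              cuspMeetsH).DeltaTp.subtype).map
            (StableCurveTemperedData.ofSpecialFibre X d SF h36 Sigma SigmaHat hsub hne hprime hp TpH HatH hle
              cuspMeetsH).ιX)
    (hSig : (StableCurveTemperedData.ofSpecialFibre X d SF h36 Sigma SigmaHat hsub hne hprime hp TpH HatH hle
      cuspMeetsH).graph.SigmaHat = {q | q.Prime})
    (hinf : W.piPM ⊓ W.hat ≤ W.piV) (hnot : ¬ (W.piPM ⊓ W.aug.ker ≤ W.hat))
    (h23 : ∀ H : Subgroup P, Cor24_family Dec Ld H →
      (∀ γ' : W.Corhat, γ' ∈ W.piPM ⊓ W.aug.ker →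
          I.map (MulAut.conj γ').toMonoidHom ≤ W.pmBox H → γ' ∈ closure (W.deltaPmBox H : Set W.Corhat)) ∧
        (∀ γ' : W.Corhat, γ' ∈ W.piPM ⊓ W.aug.ker →
          γ' ∈ closure (W.deltaPmBox H : Set W.Corhat) → γ' ∈ W.deltaPmBox H)) :
    Literature.IUT.HodgeArakelov.Cor24_i' Dec W C Ld I :=
  cor24_i'_of_hatData W C _ Dec Ld I e hmap hinertia hSig
    (StableCurveTemperedData.OfSpecialFibre.cor25_ofSpecialFibre_of_compactSpace X d SF h36 Sigma SigmaHat hsub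
      hne hprime hp TpH HatH hle cuspMeetsH).2
    (StableCurveTemperedData.OfSpecialFibre.prop24iii_ofSpecialFibre_of_compactSpace X d SF h36 Sigma SigmaHat
      hsub hne hprime hp TpH HatH hle cuspMeetsH)
    hinf hnot h23

end Cor24iReclosed

end Literature.IUT.HodgeArakelov
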